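import Mathlib
import Summits.NavierStokesRegularity.NavierStokesRegularity.Theorems.EulerZoomLiouvillePowerGaugeEulerLiouvilleHoopAxisAtom

/-!
# Hoop core — AX-3/AX-4 tools: the end functionals `endTermC`, `offsetTerm` in the chart, their height derivatives, `c = 0`

Sub-problem `NavierStokesRegularity`, crux `PowerGaugeEulerLiouville` (a crux CLASS of self-similar Euler/NS strata on the
MODEL lattice — not NS regularity, not E).  K-AXIS plates AX-3/AX-4 (LEAD 19832 ns-typeII-p2 g14; seat ns-ezl-w3 g7).
Class-free calculus for `V ∈ C¹` about the `x₂`-axis; smooth frame `f₀ = R_θ e₀`, `A = ⟪V(axisPt σ t θ), f₀⟫`, `C = V_z(axisPt σ t θ)`: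

* §1 chart forms: for `t > 0` the `endTermC` / `offsetTerm` integrands `⟨(γ(y₂ − c₂) + V_z)V_r⟩(σ,t)` and `⟨−(c₀ê_r⁰ + c₁ê_r¹)V_z⟩(σ,t)`
  are `(2π)⁻¹ ∫₀^{2π}` of `(γ(σ − c₂) + C)A` and `−(c₀ cos θ + c₁ sin θ)C`; hence (a.e. on `(0, T₀]`)
  `endTermC γ c V T₀ σ = ∫₀^{T₀} (2π)⁻¹∫₀^{2π} (γ(σ − c₂) + C)A dθ dt`, `offsetTerm γ c V T₀ σ = γ ∫₀^{T₀} (2π)⁻¹∫₀^{2π} −(c₀cos θ + c₁sin θ)C dθ dt`;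
* §2 the chart integrands and their height derivatives `(γ + ⟪DV e_z, e_z⟫)A + (γ(σ − c₂) + C)⟪DV e_z, f₀⟫`,
  `−(c₀ cos θ + c₁ sin θ)⟪DV e_z, e_z⟫` are jointly continuous in `(σ, t, θ)`; differentiation under `∫dθ` and then under `∫₀^{T₀}dt`;
* §3 **`hasDerivAt_endTermC`**, **`hasDerivAt_offsetTerm`** (every `σ`, every `T₀ ≥ 0`) with the derivative an explicit
  `∫₀^{T₀}(2π)⁻¹∫₀^{2π}(…)dθ dt` that is CONTINUOUS in `σ` (`continuous_deriv_endTermC_chart`, for the `σ`-FTC of AX-4);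
* §4 `c = 0`: `endTermC γ 0 V = endTerm γ V`, `offsetTerm γ 0 V T₀ σ = 0`.

WHAT THIS IS NOT: not NS, not E — calculus; 19832 OPEN; NS regularity NOT proved.  [folklore (differentiation under the integral sign)]
-/

noncomputable section

open MeasureTheory Set WithLp Metric Real Function Filter Topology intervalIntegral
open scoped InnerProductSpace RealInnerProductSpace

set_option linter.dupNamespace false

namespace Summit.NavierStokesRegularity.NavierStokesRegularity.Theorems.PowerGaugeEulerLiouville.HoopCore

open Literature.Analysis Literature.Analysis.FluidPDE

variable {V : EuclideanSpace ℝ (Fin 3) → EuclideanSpace ℝ (Fin 3)}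

/-! ## §1 Chart forms of the end integrands and of `endTermC`, `offsetTerm` -/

/-- The components of the radial frame vector on the circle: `ê_r(y)₀ = cos θ`, `ê_r(y)₁ = sin θ` (`t > 0`). [folklore] -/
theorem eR_axisPt_apply (s : ℝ) {t : ℝ} (ht : 0 < t) (θ : ℝ) :
    eR (axisPt s t θ) 0 = Real.cos θ ∧ eR (axisPt s t θ) 1 = Real.sin θ := by
  rw [eR_axisPt s ht θ]
  constructor <;> simp [rotZ]

/-- **Chart form of the `endTermC` integrand** (`t > 0`):
`circleAvg (fun y => (γ(y₂ − c₂) + V_z y) V_r y) σ t = (2π)⁻¹ ∫₀^{2π} (γ(σ − c₂) + C) A dθ`. [folklore] -/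
theorem circleAvg_endC_eq_chart (V : EuclideanSpace ℝ (Fin 3) → EuclideanSpace ℝ (Fin 3)) (γ : ℝ) (c : EuclideanSpace ℝ (Fin 3))
    (σ : ℝ) {t : ℝ} (ht : 0 < t) :
    circleAvg (fun y => (γ * (y 2 - c 2) + axialVelocity V y) * radialVelocity V y) σ t =
      1 / (2 * Real.pi) * ∫ θ in (0 : ℝ)..2 * Real.pi,
        (γ * (σ - c 2) + axialVelocity V (axisPt σ t θ)) *
          ⟪V (axisPt σ t θ), rotZ θ (EuclideanSpace.single (0 : Fin 3) (1 : ℝ))⟫ := by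
  rw [circleAvg]
  congr 1
  refine intervalIntegral.integral_congr fun θ _ => ?_
  simp only [(axisPt_apply σ t θ).2.2, inner_rotZ_single_zero_eq_radialVelocity V σ ht θ]

/-- **Chart form of the `offsetTerm` integrand** (`t > 0`):
`circleAvg (fun y => (−(c₀ ê_r(y)₀ + c₁ ê_r(y)₁)) V_z y) σ t = (2π)⁻¹ ∫₀^{2π} (−(c₀ cos θ + c₁ sin θ)) C dθ`. [folklore] -/
theorem circleAvg_offset_eq_chart (V : EuclideanSpace ℝ (Fin 3) → EuclideanSpace ℝ (Fin 3)) (c : EuclideanSpace ℝ (Fin 3))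
    (σ : ℝ) {t : ℝ} (ht : 0 < t) :
    circleAvg (fun y => (-(c 0 * eR y 0 + c 1 * eR y 1)) * axialVelocity V y) σ t =
      1 / (2 * Real.pi) * ∫ θ in (0 : ℝ)..2 * Real.pi,
        (-(c 0 * Real.cos θ + c 1 * Real.sin θ)) * axialVelocity V (axisPt σ t θ) := by
  rw [circleAvg]
  congr 1
  refine intervalIntegral.integral_congr fun θ _ => ?_
  simp only [(eR_axisPt_apply σ ht θ).1, (eR_axisPt_apply σ ht θ).2]

/-- **`endTermC` in the chart** (`T₀ ≥ 0`; the two integrands agree for `t ∈ (0, T₀]`, i.e. a.e. on the interval):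
`endTermC γ c V T₀ σ = ∫₀^{T₀} (2π)⁻¹ ∫₀^{2π} (γ(σ − c₂) + C) A dθ dt`. [folklore] -/
theorem endTermC_eq_chart (V : EuclideanSpace ℝ (Fin 3) → EuclideanSpace ℝ (Fin 3)) (γ : ℝ) (c : EuclideanSpace ℝ (Fin 3))
    {T₀ : ℝ} (hT₀ : 0 ≤ T₀) (σ : ℝ) :
    endTermC γ c V T₀ σ = ∫ t in (0 : ℝ)..T₀, 1 / (2 * Real.pi) * ∫ θ in (0 : ℝ)..2 * Real.pi,
        (γ * (σ - c 2) + axialVelocity V (axisPt σ t θ)) *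
          ⟪V (axisPt σ t θ), rotZ θ (EuclideanSpace.single (0 : Fin 3) (1 : ℝ))⟫ := by
  rw [endTermC]
  refine intervalIntegral.integral_congr_ae (Filter.Eventually.of_forall fun t ht => ?_)
  rw [uIoc_of_le hT₀] at ht
  exact circleAvg_endC_eq_chart V γ c σ ht.1

/-- **`offsetTerm` in the chart** (`T₀ ≥ 0`):
`offsetTerm γ c V T₀ σ = γ ∫₀^{T₀} (2π)⁻¹ ∫₀^{2π} (−(c₀ cos θ + c₁ sin θ)) C dθ dt`. [folklore] -/
theorem offsetTerm_eq_chart (V : EuclideanSpace ℝ (Fin 3) → EuclideanSpace ℝ (Fin 3)) (γ : ℝ) (c : EuclideanSpace ℝ (Fin 3))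
    {T₀ : ℝ} (hT₀ : 0 ≤ T₀) (σ : ℝ) :
    offsetTerm γ c V T₀ σ = γ * ∫ t in (0 : ℝ)..T₀, 1 / (2 * Real.pi) * ∫ θ in (0 : ℝ)..2 * Real.pi,
        (-(c 0 * Real.cos θ + c 1 * Real.sin θ)) * axialVelocity V (axisPt σ t θ) := by
  rw [offsetTerm]
  congr 1
  refine intervalIntegral.integral_congr_ae (Filter.Eventually.of_forall fun t ht => ?_)
  rw [uIoc_of_le hT₀] at ht
  exact circleAvg_offset_eq_chart V c σ ht.1

/-! ## §2 The chart integrands: joint continuity and height derivatives -/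

/-- The `endTermC` chart integrand `(σ, t, θ) ↦ (γ(σ − c₂) + C) A` is jointly continuous. [folklore] -/
theorem continuous_endC_chart (hV : Continuous V) (γ : ℝ) (c : EuclideanSpace ℝ (Fin 3)) :
    Continuous fun p : ℝ × ℝ × ℝ => (γ * (p.1 - c 2) + axialVelocity V (axisPt p.1 p.2.1 p.2.2)) *
      ⟪V (axisPt p.1 p.2.1 p.2.2), rotZ p.2.2 (EuclideanSpace.single (0 : Fin 3) (1 : ℝ))⟫ :=
  ((continuous_const.mul (continuous_fst.sub continuous_const)).add (continuous_sliceC hV)).mul (continuous_sliceA hV)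

/-- The height derivative of the `endTermC` chart integrand, `(γ + ⟪DV e_z, e_z⟫) A + (γ(σ − c₂) + C) ⟪DV e_z, f₀⟫`, is jointly
continuous (`V ∈ C¹`). [folklore] -/
theorem continuous_endC_chart_deriv (hV : ContDiff ℝ 1 V) (γ : ℝ) (c : EuclideanSpace ℝ (Fin 3)) :
    Continuous fun p : ℝ × ℝ × ℝ =>
      (γ + ⟪fderiv ℝ V (axisPt p.1 p.2.1 p.2.2) eZ, eZ⟫) *
          ⟪V (axisPt p.1 p.2.1 p.2.2), rotZ p.2.2 (EuclideanSpace.single (0 : Fin 3) (1 : ℝ))⟫ +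
        (γ * (p.1 - c 2) + axialVelocity V (axisPt p.1 p.2.1 p.2.2)) *
          ⟪fderiv ℝ V (axisPt p.1 p.2.1 p.2.2) eZ, rotZ p.2.2 (EuclideanSpace.single (0 : Fin 3) (1 : ℝ))⟫ := by
  have hVc : Continuous V := hV.continuous
  have hZZ := continuous_sliceEntry hV (u := fun _ => eZ) (w := fun _ => eZ) continuous_const continuous_const
  have hZ0 := continuous_sliceEntry hV (u := fun _ => eZ) (w := fun θ => rotZ θ (EuclideanSpace.single (0 : Fin 3) (1 : ℝ)))
    continuous_const continuous_rotZ_single_zero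
  exact ((continuous_const.add hZZ).mul (continuous_sliceA hVc)).add
    (((continuous_const.mul (continuous_fst.sub continuous_const)).add (continuous_sliceC hVc)).mul hZ0)

/-- The `offsetTerm` chart integrand `(σ, t, θ) ↦ (−(c₀ cos θ + c₁ sin θ)) C` is jointly continuous. [folklore] -/
theorem continuous_offset_chart (hV : Continuous V) (c : EuclideanSpace ℝ (Fin 3)) :
    Continuous fun p : ℝ × ℝ × ℝ => (-(c 0 * Real.cos p.2.2 + c 1 * Real.sin p.2.2)) * axialVelocity V (axisPt p.1 p.2.1 p.2.2) := by
  have h1 : Continuous fun p : ℝ × ℝ × ℝ => (-(c 0 * Real.cos p.2.2 + c 1 * Real.sin p.2.2)) := by fun_prop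
  exact h1.mul (continuous_sliceC hV)

/-- The height derivative of the `offsetTerm` chart integrand, `(−(c₀ cos θ + c₁ sin θ)) ⟪DV e_z, e_z⟫`, is jointly continuous
(`V ∈ C¹`). [folklore] -/
theorem continuous_offset_chart_deriv (hV : ContDiff ℝ 1 V) (c : EuclideanSpace ℝ (Fin 3)) :
    Continuous fun p : ℝ × ℝ × ℝ =>
      (-(c 0 * Real.cos p.2.2 + c 1 * Real.sin p.2.2)) * ⟪fderiv ℝ V (axisPt p.1 p.2.1 p.2.2) eZ, eZ⟫ := by
  have h1 : Continuous fun p : ℝ × ℝ × ℝ => (-(c 0 * Real.cos p.2.2 + c 1 * Real.sin p.2.2)) := by fun_prop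
  exact h1.mul (continuous_sliceEntry hV (u := fun _ => eZ) (w := fun _ => eZ) continuous_const continuous_const)

/-- **Height derivative of the `endTermC` chart integrand** (every `σ, t, θ`; `V` differentiable):
`∂_σ [(γ(σ − c₂) + C) A] = (γ + ⟪DV e_z, e_z⟫) A + (γ(σ − c₂) + C) ⟪DV e_z, f₀⟫`. [folklore] -/
theorem hasDerivAt_endC_chart (hV : Differentiable ℝ V) (γ : ℝ) (c : EuclideanSpace ℝ (Fin 3)) (σ t θ : ℝ) :
    HasDerivAt (fun σ : ℝ => (γ * (σ - c 2) + axialVelocity V (axisPt σ t θ)) *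
        ⟪V (axisPt σ t θ), rotZ θ (EuclideanSpace.single (0 : Fin 3) (1 : ℝ))⟫)
      ((γ + ⟪fderiv ℝ V (axisPt σ t θ) eZ, eZ⟫) * ⟪V (axisPt σ t θ), rotZ θ (EuclideanSpace.single (0 : Fin 3) (1 : ℝ))⟫ +
        (γ * (σ - c 2) + axialVelocity V (axisPt σ t θ)) *
          ⟪fderiv ℝ V (axisPt σ t θ) eZ, rotZ θ (EuclideanSpace.single (0 : Fin 3) (1 : ℝ))⟫) σ := by
  have hA := hasDerivAt_sliceA_height hV σ t θ
  have hC := hasDerivAt_sliceC_height hV σ t θ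
  have hL : HasDerivAt (fun σ : ℝ => γ * (σ - c 2)) (γ * 1) σ := ((hasDerivAt_id σ).sub_const (c 2)).const_mul γ
  exact ((hL.add hC).mul hA).congr_deriv (by simp only [Pi.add_apply]; ring)

/-- **Height derivative of the `offsetTerm` chart integrand**: `∂_σ [−(c₀ cos θ + c₁ sin θ) C] = −(c₀ cos θ + c₁ sin θ) ⟪DV e_z, e_z⟫`.
[folklore] -/
theorem hasDerivAt_offset_chart (hV : Differentiable ℝ V) (c : EuclideanSpace ℝ (Fin 3)) (σ t θ : ℝ) :
    HasDerivAt (fun σ : ℝ => (-(c 0 * Real.cos θ + c 1 * Real.sin θ)) * axialVelocity V (axisPt σ t θ))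
      ((-(c 0 * Real.cos θ + c 1 * Real.sin θ)) * ⟪fderiv ℝ V (axisPt σ t θ) eZ, eZ⟫) σ :=
  (hasDerivAt_sliceC_height hV σ t θ).const_mul _

/-- **Height derivative of the chart `endTermC` integrand average** (every `σ`, every `t`):
`∂_σ (2π)⁻¹∫₀^{2π} (γ(σ − c₂) + C) A dθ = (2π)⁻¹∫₀^{2π} [(γ + ⟪DV e_z, e_z⟫) A + (γ(σ − c₂) + C) ⟪DV e_z, f₀⟫] dθ`. [folklore] -/
theorem hasDerivAt_chartAvg_endC_height (hV : ContDiff ℝ 1 V) (γ : ℝ) (c : EuclideanSpace ℝ (Fin 3)) (σ t : ℝ) :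
    HasDerivAt (fun σ : ℝ => 1 / (2 * Real.pi) * ∫ θ in (0 : ℝ)..2 * Real.pi,
        (γ * (σ - c 2) + axialVelocity V (axisPt σ t θ)) *
          ⟪V (axisPt σ t θ), rotZ θ (EuclideanSpace.single (0 : Fin 3) (1 : ℝ))⟫)
      (1 / (2 * Real.pi) * ∫ θ in (0 : ℝ)..2 * Real.pi,
        ((γ + ⟪fderiv ℝ V (axisPt σ t θ) eZ, eZ⟫) * ⟪V (axisPt σ t θ), rotZ θ (EuclideanSpace.single (0 : Fin 3) (1 : ℝ))⟫ +
          (γ * (σ - c 2) + axialVelocity V (axisPt σ t θ)) *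
            ⟪fderiv ℝ V (axisPt σ t θ) eZ, rotZ θ (EuclideanSpace.single (0 : Fin 3) (1 : ℝ))⟫)) σ := by
  have hF := continuous_uncurry_radius (continuous_endC_chart hV.continuous γ c) t
  have hF' := continuous_uncurry_radius (continuous_endC_chart_deriv hV γ c) t
  exact (hasDerivAt_intervalIntegral_of_continuous (fun σ θ => hasDerivAt_endC_chart (hV.differentiable one_ne_zero) γ c σ t θ)
    hF hF' 0 (2 * Real.pi) σ).const_mul _

/-- **Height derivative of the chart `offsetTerm` integrand average** (every `σ`, every `t`). [folklore] -/
theorem hasDerivAt_chartAvg_offset_height (hV : ContDiff ℝ 1 V) (c : EuclideanSpace ℝ (Fin 3)) (σ t : ℝ) :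
    HasDerivAt (fun σ : ℝ => 1 / (2 * Real.pi) * ∫ θ in (0 : ℝ)..2 * Real.pi,
        (-(c 0 * Real.cos θ + c 1 * Real.sin θ)) * axialVelocity V (axisPt σ t θ))
      (1 / (2 * Real.pi) * ∫ θ in (0 : ℝ)..2 * Real.pi,
        (-(c 0 * Real.cos θ + c 1 * Real.sin θ)) * ⟪fderiv ℝ V (axisPt σ t θ) eZ, eZ⟫) σ := by
  have hF := continuous_uncurry_radius (continuous_offset_chart hV.continuous c) t
  have hF' := continuous_uncurry_radius (continuous_offset_chart_deriv hV c) t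
  exact (hasDerivAt_intervalIntegral_of_continuous (fun σ θ => hasDerivAt_offset_chart (hV.differentiable one_ne_zero) c σ t θ)
    hF hF' 0 (2 * Real.pi) σ).const_mul _

/-- The chart `endTermC` average `(σ, t) ↦ (2π)⁻¹∫₀^{2π} (γ(σ − c₂) + C) A dθ` is jointly continuous. [folklore] -/
theorem continuous_chartAvg_endC (hV : Continuous V) (γ : ℝ) (c : EuclideanSpace ℝ (Fin 3)) :
    Continuous (uncurry fun σ t : ℝ => 1 / (2 * Real.pi) * ∫ θ in (0 : ℝ)..2 * Real.pi,
      (γ * (σ - c 2) + axialVelocity V (axisPt σ t θ)) *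
        ⟪V (axisPt σ t θ), rotZ θ (EuclideanSpace.single (0 : Fin 3) (1 : ℝ))⟫) :=
  continuous_const.mul (continuous_parametric₂_intervalIntegral
    (F := fun σ t θ => (γ * (σ - c 2) + axialVelocity V (axisPt σ t θ)) *
      ⟪V (axisPt σ t θ), rotZ θ (EuclideanSpace.single (0 : Fin 3) (1 : ℝ))⟫) (continuous_endC_chart hV γ c) _ _)

/-- The chart average of the HEIGHT DERIVATIVE of the `endTermC` integrand is jointly continuous in `(σ, t)` (`V ∈ C¹`). [folklore] -/
theorem continuous_chartAvg_endC_deriv (hV : ContDiff ℝ 1 V) (γ : ℝ) (c : EuclideanSpace ℝ (Fin 3)) :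
    Continuous (uncurry fun σ t : ℝ => 1 / (2 * Real.pi) * ∫ θ in (0 : ℝ)..2 * Real.pi,
      ((γ + ⟪fderiv ℝ V (axisPt σ t θ) eZ, eZ⟫) * ⟪V (axisPt σ t θ), rotZ θ (EuclideanSpace.single (0 : Fin 3) (1 : ℝ))⟫ +
        (γ * (σ - c 2) + axialVelocity V (axisPt σ t θ)) *
          ⟪fderiv ℝ V (axisPt σ t θ) eZ, rotZ θ (EuclideanSpace.single (0 : Fin 3) (1 : ℝ))⟫)) :=
  continuous_const.mul (continuous_parametric₂_intervalIntegral
    (F := fun σ t θ => (γ + ⟪fderiv ℝ V (axisPt σ t θ) eZ, eZ⟫) * ⟪V (axisPt σ t θ), rotZ θ (EuclideanSpace.single (0 : Fin 3) (1 : ℝ))⟫ +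
      (γ * (σ - c 2) + axialVelocity V (axisPt σ t θ)) * ⟪fderiv ℝ V (axisPt σ t θ) eZ, rotZ θ (EuclideanSpace.single (0 : Fin 3) (1 : ℝ))⟫)
    (continuous_endC_chart_deriv hV γ c) _ _)

/-- The chart `offsetTerm` average is jointly continuous in `(σ, t)`. [folklore] -/
theorem continuous_chartAvg_offset (hV : Continuous V) (c : EuclideanSpace ℝ (Fin 3)) :
    Continuous (uncurry fun σ t : ℝ => 1 / (2 * Real.pi) * ∫ θ in (0 : ℝ)..2 * Real.pi,
      (-(c 0 * Real.cos θ + c 1 * Real.sin θ)) * axialVelocity V (axisPt σ t θ)) :=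
  continuous_const.mul (continuous_parametric₂_intervalIntegral
    (F := fun σ t θ => (-(c 0 * Real.cos θ + c 1 * Real.sin θ)) * axialVelocity V (axisPt σ t θ)) (continuous_offset_chart hV c) _ _)

/-- The chart average of the height derivative of the `offsetTerm` integrand is jointly continuous in `(σ, t)` (`V ∈ C¹`). [folklore] -/
theorem continuous_chartAvg_offset_deriv (hV : ContDiff ℝ 1 V) (c : EuclideanSpace ℝ (Fin 3)) :
    Continuous (uncurry fun σ t : ℝ => 1 / (2 * Real.pi) * ∫ θ in (0 : ℝ)..2 * Real.pi,
      (-(c 0 * Real.cos θ + c 1 * Real.sin θ)) * ⟪fderiv ℝ V (axisPt σ t θ) eZ, eZ⟫) :=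
  continuous_const.mul (continuous_parametric₂_intervalIntegral
    (F := fun σ t θ => (-(c 0 * Real.cos θ + c 1 * Real.sin θ)) * ⟪fderiv ℝ V (axisPt σ t θ) eZ, eZ⟫) (continuous_offset_chart_deriv hV c) _ _)

/-! ## §3 Height derivatives of `endTermC` and `offsetTerm` -/

/-- **`∂_σ ∫₀^{T₀} (chart endTermC average) dt = ∫₀^{T₀} (chart average of the height derivative) dt`** (every `σ`, every `T₀`;
`V ∈ C¹`): differentiation under `∫₀^{T₀} dt` of a jointly continuous family with jointly continuous `σ`-derivative. [folklore] -/
theorem hasDerivAt_intervalIntegral_chartAvg_endC (hV : ContDiff ℝ 1 V) (γ : ℝ) (c : EuclideanSpace ℝ (Fin 3)) (T₀ σ : ℝ) :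
    HasDerivAt (fun σ : ℝ => ∫ t in (0 : ℝ)..T₀, 1 / (2 * Real.pi) * ∫ θ in (0 : ℝ)..2 * Real.pi,
        (γ * (σ - c 2) + axialVelocity V (axisPt σ t θ)) *
          ⟪V (axisPt σ t θ), rotZ θ (EuclideanSpace.single (0 : Fin 3) (1 : ℝ))⟫)
      (∫ t in (0 : ℝ)..T₀, 1 / (2 * Real.pi) * ∫ θ in (0 : ℝ)..2 * Real.pi,
        ((γ + ⟪fderiv ℝ V (axisPt σ t θ) eZ, eZ⟫) * ⟪V (axisPt σ t θ), rotZ θ (EuclideanSpace.single (0 : Fin 3) (1 : ℝ))⟫ +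
          (γ * (σ - c 2) + axialVelocity V (axisPt σ t θ)) *
            ⟪fderiv ℝ V (axisPt σ t θ) eZ, rotZ θ (EuclideanSpace.single (0 : Fin 3) (1 : ℝ))⟫)) σ :=
  hasDerivAt_intervalIntegral_of_continuous (fun σ t => hasDerivAt_chartAvg_endC_height hV γ c σ t)
    (continuous_chartAvg_endC hV.continuous γ c) (continuous_chartAvg_endC_deriv hV γ c) 0 T₀ σ

/-- **`∂_σ ∫₀^{T₀} (chart offsetTerm average) dt = ∫₀^{T₀} (chart average of the height derivative) dt`** (every `σ, T₀`; `V ∈ C¹`).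
[folklore] -/
theorem hasDerivAt_intervalIntegral_chartAvg_offset (hV : ContDiff ℝ 1 V) (c : EuclideanSpace ℝ (Fin 3)) (T₀ σ : ℝ) :
    HasDerivAt (fun σ : ℝ => ∫ t in (0 : ℝ)..T₀, 1 / (2 * Real.pi) * ∫ θ in (0 : ℝ)..2 * Real.pi,
        (-(c 0 * Real.cos θ + c 1 * Real.sin θ)) * axialVelocity V (axisPt σ t θ))
      (∫ t in (0 : ℝ)..T₀, 1 / (2 * Real.pi) * ∫ θ in (0 : ℝ)..2 * Real.pi,
        (-(c 0 * Real.cos θ + c 1 * Real.sin θ)) * ⟪fderiv ℝ V (axisPt σ t θ) eZ, eZ⟫) σ :=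
  hasDerivAt_intervalIntegral_of_continuous (fun σ t => hasDerivAt_chartAvg_offset_height hV c σ t)
    (continuous_chartAvg_offset hV.continuous c) (continuous_chartAvg_offset_deriv hV c) 0 T₀ σ

/-- **HEIGHT DERIVATIVE OF `endTermC`** (`V ∈ C¹`, `T₀ ≥ 0`, every `σ`):
`∂_σ endTermC γ c V T₀ σ = ∫₀^{T₀} (2π)⁻¹∫₀^{2π} [(γ + ⟪DV e_z, e_z⟫) A + (γ(σ − c₂) + C) ⟪DV e_z, f₀⟫] dθ dt`. [folklore] -/
theorem hasDerivAt_endTermC (hV : ContDiff ℝ 1 V) (γ : ℝ) (c : EuclideanSpace ℝ (Fin 3)) {T₀ : ℝ} (hT₀ : 0 ≤ T₀) (σ : ℝ) :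
    HasDerivAt (endTermC γ c V T₀)
      (∫ t in (0 : ℝ)..T₀, 1 / (2 * Real.pi) * ∫ θ in (0 : ℝ)..2 * Real.pi,
        ((γ + ⟪fderiv ℝ V (axisPt σ t θ) eZ, eZ⟫) * ⟪V (axisPt σ t θ), rotZ θ (EuclideanSpace.single (0 : Fin 3) (1 : ℝ))⟫ +
          (γ * (σ - c 2) + axialVelocity V (axisPt σ t θ)) *
            ⟪fderiv ℝ V (axisPt σ t θ) eZ, rotZ θ (EuclideanSpace.single (0 : Fin 3) (1 : ℝ))⟫)) σ := by
  have e : endTermC γ c V T₀ = fun σ : ℝ => ∫ t in (0 : ℝ)..T₀, 1 / (2 * Real.pi) * ∫ θ in (0 : ℝ)..2 * Real.pi,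
      (γ * (σ - c 2) + axialVelocity V (axisPt σ t θ)) *
        ⟪V (axisPt σ t θ), rotZ θ (EuclideanSpace.single (0 : Fin 3) (1 : ℝ))⟫ := by
    funext σ; exact endTermC_eq_chart V γ c hT₀ σ
  rw [e]
  exact hasDerivAt_intervalIntegral_chartAvg_endC hV γ c T₀ σ

/-- **`deriv` form of the height derivative of `endTermC`** (`V ∈ C¹`, `T₀ ≥ 0`). [folklore] -/
theorem deriv_endTermC (hV : ContDiff ℝ 1 V) (γ : ℝ) (c : EuclideanSpace ℝ (Fin 3)) {T₀ : ℝ} (hT₀ : 0 ≤ T₀) (σ : ℝ) :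
    deriv (endTermC γ c V T₀) σ =
      ∫ t in (0 : ℝ)..T₀, 1 / (2 * Real.pi) * ∫ θ in (0 : ℝ)..2 * Real.pi,
        ((γ + ⟪fderiv ℝ V (axisPt σ t θ) eZ, eZ⟫) * ⟪V (axisPt σ t θ), rotZ θ (EuclideanSpace.single (0 : Fin 3) (1 : ℝ))⟫ +
          (γ * (σ - c 2) + axialVelocity V (axisPt σ t θ)) *
            ⟪fderiv ℝ V (axisPt σ t θ) eZ, rotZ θ (EuclideanSpace.single (0 : Fin 3) (1 : ℝ))⟫) :=
  (hasDerivAt_endTermC hV γ c hT₀ σ).deriv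

/-- **The height derivative of `endTermC` is CONTINUOUS in `σ`** (in its chart form; `V ∈ C¹`) — the input of the `σ`-FTC in AX-4.
[folklore] -/
theorem continuous_deriv_endTermC_chart (hV : ContDiff ℝ 1 V) (γ : ℝ) (c : EuclideanSpace ℝ (Fin 3)) (T₀ : ℝ) :
    Continuous fun σ : ℝ => ∫ t in (0 : ℝ)..T₀, 1 / (2 * Real.pi) * ∫ θ in (0 : ℝ)..2 * Real.pi,
        ((γ + ⟪fderiv ℝ V (axisPt σ t θ) eZ, eZ⟫) * ⟪V (axisPt σ t θ), rotZ θ (EuclideanSpace.single (0 : Fin 3) (1 : ℝ))⟫ +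
          (γ * (σ - c 2) + axialVelocity V (axisPt σ t θ)) *
            ⟪fderiv ℝ V (axisPt σ t θ) eZ, rotZ θ (EuclideanSpace.single (0 : Fin 3) (1 : ℝ))⟫) :=
  intervalIntegral.continuous_parametric_intervalIntegral_of_continuous' (continuous_chartAvg_endC_deriv hV γ c) 0 T₀

/-- `endTermC` is continuous in the height (`V ∈ C¹`, `T₀ ≥ 0`). [folklore] -/
theorem continuous_endTermC (hV : ContDiff ℝ 1 V) (γ : ℝ) (c : EuclideanSpace ℝ (Fin 3)) {T₀ : ℝ} (hT₀ : 0 ≤ T₀) :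
    Continuous (endTermC γ c V T₀) :=
  continuous_iff_continuousAt.2 fun σ => (hasDerivAt_endTermC hV γ c hT₀ σ).continuousAt

/-- **HEIGHT DERIVATIVE OF `offsetTerm`** (`V ∈ C¹`, `T₀ ≥ 0`, every `σ`):
`∂_σ offsetTerm γ c V T₀ σ = γ ∫₀^{T₀} (2π)⁻¹∫₀^{2π} (−(c₀ cos θ + c₁ sin θ)) ⟪DV e_z, e_z⟫ dθ dt`. [folklore] -/
theorem hasDerivAt_offsetTerm (hV : ContDiff ℝ 1 V) (γ : ℝ) (c : EuclideanSpace ℝ (Fin 3)) {T₀ : ℝ} (hT₀ : 0 ≤ T₀) (σ : ℝ) :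
    HasDerivAt (offsetTerm γ c V T₀)
      (γ * ∫ t in (0 : ℝ)..T₀, 1 / (2 * Real.pi) * ∫ θ in (0 : ℝ)..2 * Real.pi,
        (-(c 0 * Real.cos θ + c 1 * Real.sin θ)) * ⟪fderiv ℝ V (axisPt σ t θ) eZ, eZ⟫) σ := by
  have e : offsetTerm γ c V T₀ = fun σ : ℝ => γ * ∫ t in (0 : ℝ)..T₀, 1 / (2 * Real.pi) * ∫ θ in (0 : ℝ)..2 * Real.pi,
      (-(c 0 * Real.cos θ + c 1 * Real.sin θ)) * axialVelocity V (axisPt σ t θ) := by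
    funext σ; exact offsetTerm_eq_chart V γ c hT₀ σ
  rw [e]
  exact (hasDerivAt_intervalIntegral_chartAvg_offset hV c T₀ σ).const_mul γ

/-- **`deriv` form of the height derivative of `offsetTerm`** (`V ∈ C¹`, `T₀ ≥ 0`). [folklore] -/
theorem deriv_offsetTerm (hV : ContDiff ℝ 1 V) (γ : ℝ) (c : EuclideanSpace ℝ (Fin 3)) {T₀ : ℝ} (hT₀ : 0 ≤ T₀) (σ : ℝ) :
    deriv (offsetTerm γ c V T₀) σ =
      γ * ∫ t in (0 : ℝ)..T₀, 1 / (2 * Real.pi) * ∫ θ in (0 : ℝ)..2 * Real.pi,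
        (-(c 0 * Real.cos θ + c 1 * Real.sin θ)) * ⟪fderiv ℝ V (axisPt σ t θ) eZ, eZ⟫ :=
  (hasDerivAt_offsetTerm hV γ c hT₀ σ).deriv

/-- **The height derivative of `offsetTerm` is continuous in `σ`** (chart form; `V ∈ C¹`). [folklore] -/
theorem continuous_deriv_offsetTerm_chart (hV : ContDiff ℝ 1 V) (γ : ℝ) (c : EuclideanSpace ℝ (Fin 3)) (T₀ : ℝ) :
    Continuous fun σ : ℝ => γ * ∫ t in (0 : ℝ)..T₀, 1 / (2 * Real.pi) * ∫ θ in (0 : ℝ)..2 * Real.pi,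
        (-(c 0 * Real.cos θ + c 1 * Real.sin θ)) * ⟪fderiv ℝ V (axisPt σ t θ) eZ, eZ⟫ :=
  continuous_const.mul
    (intervalIntegral.continuous_parametric_intervalIntegral_of_continuous' (continuous_chartAvg_offset_deriv hV c) 0 T₀)

/-- `offsetTerm` is continuous in the height (`V ∈ C¹`, `T₀ ≥ 0`). [folklore] -/
theorem continuous_offsetTerm (hV : ContDiff ℝ 1 V) (γ : ℝ) (c : EuclideanSpace ℝ (Fin 3)) {T₀ : ℝ} (hT₀ : 0 ≤ T₀) :
    Continuous (offsetTerm γ c V T₀) :=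
  continuous_iff_continuousAt.2 fun σ => (hasDerivAt_offsetTerm hV γ c hT₀ σ).continuousAt

/-! ## §4 Centre `c = 0`: `endTermC γ 0 = endTerm γ`, `offsetTerm γ 0 = 0` -/

/-- With the similarity centre at the origin the general end functional is the radial one: `endTermC γ 0 V = endTerm γ V`. [folklore] -/
theorem endTermC_zero (γ : ℝ) (V : EuclideanSpace ℝ (Fin 3) → EuclideanSpace ℝ (Fin 3)) : endTermC γ 0 V = endTerm γ V := by
  funext T₀ σ
  simp only [endTermC, endTerm, PiLp.zero_apply, sub_zero]

/-- With the similarity centre at the origin the offset functional vanishes: `offsetTerm γ 0 V T₀ σ = 0`. [folklore] -/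
theorem offsetTerm_zero (γ : ℝ) (V : EuclideanSpace ℝ (Fin 3) → EuclideanSpace ℝ (Fin 3)) (T₀ σ : ℝ) :
    offsetTerm γ 0 V T₀ σ = 0 := by
  simp [offsetTerm, circleAvg]

/-- Hence `deriv (offsetTerm γ 0 V T₀) σ = 0`. [folklore] -/
theorem deriv_offsetTerm_zero (γ : ℝ) (V : EuclideanSpace ℝ (Fin 3) → EuclideanSpace ℝ (Fin 3)) (T₀ σ : ℝ) :
    deriv (offsetTerm γ 0 V T₀) σ = 0 := by
  have e : offsetTerm γ 0 V T₀ = fun _ => 0 := funext fun σ => offsetTerm_zero γ V T₀ σ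
  rw [e, deriv_const]

end Summit.NavierStokesRegularity.NavierStokesRegularity.Theorems.PowerGaugeEulerLiouville.HoopCore

end
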